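import Literature.Probability.Percolation.QuadCrossingDualSeparatorArm
import HarnessLib

/-!
# Decoupling over the bottom open cluster (Lemma 6.1, case (3), dual picture)

Topic `Probability/Percolation`; proofs file towards the named fact `SchrammSmirnov2011_lemma_6_1`
(`QuadCrossingContinuity.lean`; O. Schramm, S. Smirnov, *On the scaling limits of planar
percolation*, Ann. Probab. 39 (2011), arXiv:1101.5820, proof of Lemma 6.1, case (2), eq. (6.2), and
p. 23: "the proof in case (3) is symmetric to that of case (2)").

The one-sided decoupling `Charts.measureReal_crossed_not_crossed_far_le` of case (2) conditions on
the explored region of the lowest open crossing.  Its dual counterpart, needed for case (3), conditions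
on the bottom open cluster `d = C_b(ω)` of the small quad (`QuadCrossingBottomCluster.lean`,
bookkeeping in `QuadCrossingBottomClusterData.lean`): `Charts.measureReal_dual_far_le` bounds the
probability of `{dual crossing of Q'} ∩ {open transversal crossing of Q} ∩ {x♭ far from ∂₃Q}` by
`η · P(dual crossing of Q')`, where `η` bounds the probability of the open annulus crossing of the
fresh arm (`Charts.mem_annulusOpenCrossingOff_of_dual`).  Ingredients proved here: the wall point as a
function of the datum (`Quad.topContactOf`, `Quad.dualWallPtOf`, `Quad.dualWallPt_eq`), and "a dual
crossing exists iff the bottom cluster misses `∂₃Q'`" for lattice-tame quads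
(`Quad.bottomCluster_inter_side_three_eq_empty_of_dualPath`,
`Quad.exists_dualPath_of_bottomCluster_inter_side_three_eq_empty`), which makes the event
`{dual crossing}` a function of the datum.  Everything is proved; no named fact is introduced.

## References

* O. Schramm, S. Smirnov, Ann. Probab. 39 (2011) 1768–1814, arXiv:1101.5820, proof of Lemma 6.1,
  cases (2)–(3), eq. (6.2). [SchrammSmirnov2011]
* G. Grimmett, *Percolation*, 2nd ed. (1999), §2.2, §11.2. [GrimmettPercolation1999]
-/

noncomputable section

open Set Metric Filter Function Relation
open _root_.MeasureTheory _root_.Topology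
open scoped ENNReal unitInterval
open Literature.Probability.LatticeModels
open Literature.Topology.PlaneTopology

namespace Literature.Probability.Percolation

namespace QuadCrossing

namespace Quad

variable {D : Set ℂ} {Q : Quad D} {δ : ℝ} {ω : BondConfig (Site 2)}

/-! ### The wall point as a function of the datum -/

/-- The top contact of a set `d` with the free side: `sup ({0} ∪ {θ : Q(1,θ) ∈ d})`.
[cite: SchrammSmirnov2011, proof of Lemma 6.1, case (3)] -/
def topContactOf (Q : Quad D) (d : Set ℂ) : ℝ :=
  sSup (insert 0 {t | ∃ ht : t ∈ Icc (0 : ℝ) 1, Q (1, ⟨t, ht⟩) ∈ d})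

/-- The top contact of the configuration is that of its bottom cluster. [folklore] -/
theorem topContact_eq (Q : Quad D) (δ : ℝ) (ω : BondConfig (Site 2)) :
    Q.topContact δ ω = Q.topContactOf (Q.bottomCluster δ ω) := rfl

/-- `0 ≤ θ ≤ 1` for the top contact of a set. [folklore] -/
theorem topContactOf_mem_Icc (Q : Quad D) (d : Set ℂ) : Q.topContactOf d ∈ Icc (0 : ℝ) 1 := by
  have hbdd : BddAbove (insert (0 : ℝ) {t | ∃ ht : t ∈ Icc (0 : ℝ) 1, Q (1, ⟨t, ht⟩) ∈ d}) :=
    ⟨1, fun t ht => by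
      rcases ht with rfl | ⟨ht, -⟩
      · norm_num
      · exact ht.2⟩
  refine ⟨le_csSup hbdd (mem_insert _ _), csSup_le ⟨0, mem_insert _ _⟩ fun t ht => ?_⟩
  rcases ht with rfl | ⟨ht, -⟩
  · norm_num
  · exact ht.2

/-- The wall point of a datum `d`: `Q(1, θ(d))`. [cite: SchrammSmirnov2011, proof of Lemma 6.1, case (3)] -/
def dualWallPtOf (Q : Quad D) (d : Set ℂ) : ℂ := Q (1, ⟨Q.topContactOf d, Q.topContactOf_mem_Icc d⟩)

/-- The wall point of the configuration is that of its bottom cluster. [folklore] -/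
theorem dualWallPt_eq (Q : Quad D) (δ : ℝ) (ω : BondConfig (Site 2)) :
    Q.dualWallPt δ ω = Q.dualWallPtOf (Q.bottomCluster δ ω) := rfl

/-! ### Dual crossings and the bottom cluster -/

/-- A dual crossing keeps the bottom cluster off `∂₃Q` (lattice-tame quads).
[cite: SchrammSmirnov2011, proof of Lemma 6.1, case (3)] -/
theorem bottomCluster_inter_side_three_eq_empty_of_dualPath (hδ : 0 < δ)
    (htame : ∀ p : Site 2 × Site 2, (zdGraph 2).Adj p.1 p.2 → IsPreconnected (Q.piece δ p))
    {β : ℝ → ℂ} (hβc : ContinuousOn β (Icc 0 1)) (hβQ : MapsTo β (Icc 0 1) Q.carrier)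
    (hβ0 : β 0 ∈ Q.side 0) (hβ1 : β 1 ∈ Q.side 2)
    (hβO : ∀ t ∈ Icc (0 : ℝ) 1, β t ∉ openEdgeUnion δ ω) :
    Q.bottomCluster δ ω ∩ Q.side 3 = ∅ := by
  refine eq_empty_iff_forall_notMem.2 ?_
  rintro c ⟨hc, hc3⟩
  obtain ⟨p, hp, hcp⟩ := mem_iUnion₂.1 hc
  obtain ⟨U, hUsub, hUpc, hU1, hpU⟩ := exists_isPreconnected_of_reach htame hp
  exact false_of_open_isPreconnected hδ hUpc (fun z hz => (bottomCluster_subset (hUsub hz)).1)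
    (fun z hz => (bottomCluster_subset (hUsub hz)).2) hU1 ⟨c, hpU hcp, hc3⟩ hβc hβQ hβ0 hβ1 hβO

/-- Conversely, if the bottom cluster misses `∂₃Q`, a dual crossing exists (`δ > 0`; no tameness
is needed in this direction). [cite: SchrammSmirnov2011, proof of Lemma 6.1, case (3)] -/
theorem exists_dualPath_of_bottomCluster_inter_side_three_eq_empty (hδ : 0 < δ)
    (h : Q.bottomCluster δ ω ∩ Q.side 3 = ∅) :
    ∃ β : ℝ → ℂ, ContinuousOn β (Icc 0 1) ∧ MapsTo β (Icc 0 1) Q.carrier ∧ β 0 ∈ Q.side 0 ∧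
      β 1 ∈ Q.side 2 ∧ ∀ t ∈ Icc (0 : ℝ) 1, β t ∉ openEdgeUnion δ ω := by
  set 𝒦 : Set ℂ := openEdgeUnion δ ω ∩ Q.carrier with h𝒦
  have h𝒦c : IsCompact 𝒦 := Q.isCompact_carrier.inter_left (isClosed_openEdgeUnion hδ ω)
  -- pieces covering the obstacle
  set P : (Site 2 × Site 2) → Set ℂ := fun p => {z | OpenPair ω p ∧ z ∈ Q.piece δ p} with hP
  have hPsome : ∀ p, OpenPair ω p → P p = Q.piece δ p := fun p hp => by
    ext z; simp only [hP, mem_setOf_eq, hp, true_and]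
  have hPsome' : ∀ p, ¬ OpenPair ω p → P p = ∅ := fun p hp => by
    ext z; simp only [hP, mem_setOf_eq, hp, false_and, mem_empty_iff_false]
  have hclosed : ∀ p, IsClosed (P p) := fun p => by
    by_cases hp : OpenPair ω p
    · rw [hPsome p hp]; exact (isCompact_piece p).isClosed
    · rw [hPsome' p hp]; exact isClosed_empty
  have hfin : {p | (P p).Nonempty}.Finite := by
    refine (finite_setOf_piece_nonempty (Q := Q) hδ).subset fun p hp => ?_
    by_cases hop : OpenPair ω p
    · have : (P p).Nonempty := hp
      rw [hPsome p hop] at this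
      exact ⟨hop.1, this⟩
    · have : (P p).Nonempty := hp
      rw [hPsome' p hop] at this
      exact absurd this not_nonempty_empty
  have hcover : 𝒦 ⊆ ⋃ p, P p := by
    rintro z ⟨hzO, hzQ⟩
    obtain ⟨x, y, hxy, hω, hzs⟩ := mem_openEdgeUnion_iff.1 hzO
    exact mem_iUnion.2 ⟨(x, y), ⟨hxy, hω⟩, hzs, hzQ⟩
  have hnc : ∀ C ⊆ 𝒦, IsPreconnected C → (C ∩ Q.side 1).Nonempty → (C ∩ Q.side 3).Nonempty →
      False := by
    intro C hC hCpc ⟨b, hbC, hb1⟩ ⟨c, hcC, hc3⟩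
    have hCsub : C ⊆ ⋃ p, P p := hC.trans hcover
    obtain ⟨hbO, hbQ⟩ := hC hbC
    obtain ⟨x, y, hxy, hω, hbs⟩ := mem_openEdgeUnion_iff.1 hbO
    have hbase : Q.IsBase δ ω (x, y) := ⟨⟨hxy, hω⟩, ⟨b, ⟨hbs, hbQ⟩, hb1⟩⟩
    obtain ⟨ic, hcic⟩ := mem_iUnion.1 (hCsub hcC)
    have hchain := exists_reflTransGen_of_isPreconnected P hclosed hfin hCpc hCsub
      (i₁ := (x, y)) (i₂ := ic) ⟨b, hbC, by rw [hPsome (x, y) ⟨hxy, hω⟩]; exact ⟨hbs, hbQ⟩⟩ ⟨c, hcC, hcic⟩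
    have key : ∀ j, ReflTransGen (fun i j => (C ∩ P j).Nonempty ∧ (P i ∩ P j).Nonempty) (x, y) j →
        Q.Reach δ ω j := by
      intro j hj
      induction hj with
      | refl => exact ⟨(x, y), hbase, ReflTransGen.refl⟩
      | @tail j₁ j₂ _ hst ih =>
        obtain ⟨⟨w, -, hw⟩, z, hz₁, hz₂⟩ := hst
        have hj₂ : OpenPair ω j₂ := by
          by_contra hno
          rw [hPsome' j₂ hno] at hw
          exact hw
        rw [hPsome j₁ ih.openPair] at hz₁
        rw [hPsome j₂ hj₂] at hz₂
        exact ih.of_inter hj₂ ⟨z, hz₁, hz₂⟩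
    have hic := key ic hchain
    rw [hPsome ic hic.openPair] at hcic
    have : c ∈ Q.bottomCluster δ ω ∩ Q.side 3 := ⟨piece_subset_bottomCluster hic hcic, hc3⟩
    rw [h] at this
    exact this
  obtain ⟨β, hβc, hβQ, hβ0, hβ1, hβ𝒦⟩ := Q.exists_path_avoiding_of_not_crossed' h𝒦c inter_subset_right hnc
  exact ⟨β, hβc, hβQ, hβ0, hβ1, fun t ht hO => hβ𝒦 t ht ⟨hO, hβQ ht⟩⟩

end Quad

end QuadCrossing

namespace SSContinuity

namespace Frame

variable (Φ : Frame) {D : Set ℂ} {Q Q' : QuadCrossing.Quad D}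

variable {Φ} in
/-- **Decoupling over the bottom open cluster** (see the module docstring).
[cite: SchrammSmirnov2011, proof of Lemma 6.1, case (3) via case (2), eq. (6.2)] -/
theorem Charts.measureReal_dual_far_le (hΦ : Φ.Charts Q') (hb : Φ.b = 1) (hc : Φ.c = -1)
    (hd : Φ.d = 1) (hG : ∀ t : I, Φ.G ⟨1, 2 * (t : ℝ) - 1⟩ = Q' (1, t))
    (hcar : Q'.carrier ⊆ Q.carrier) (h0 : Q'.side 0 = Q.side 0) (h1 : Q'.side 1 ⊆ Q.side 1)
    (h3 : Q'.side 3 ⊆ Q.side 3) {ρ : ℝ} (hρ : 0 < ρ) (hρ0 : ρ < Q.sideDist 0)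
    (hjoin : ∀ x ∈ Q'.side 2, Q.ShortJoin ρ x (Q.side 2))
    (htame : ∀ a b : Site 2, (zdGraph 2).Adj a b →
      IsPreconnected (segment ℝ (meshPoint Φ.δ a) (meshPoint Φ.δ b) ∩ Q.carrier))
    (htame' : ∀ p : Site 2 × Site 2, (zdGraph 2).Adj p.1 p.2 →
      IsPreconnected (Q'.piece Φ.δ p))
    {K : ℝ} (hK : 1 ≤ K)
    (harc : ∀ s t : I, dist (Q' (1, s)) (Q' (1, t)) ≤ ρ → ∀ u : I,
      ((s : ℝ) ≤ u ∧ (u : ℝ) ≤ t ∨ (t : ℝ) ≤ u ∧ (u : ℝ) ≤ s) → dist (Q' (1, u)) (Q' (1, s)) ≤ K * ρ)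
    {c₃ : ℝ} (hc₃ : 12 * (K * ρ) + 6 * Φ.δ < c₃) {η : ℝ} (hη0 : 0 ≤ η)
    (hη : ∀ x : ℂ, (bondPercolation (zdGraph 2) half).real
      (annulusOpenCrossing x Φ.δ (2 * (K * ρ) + 4 * Φ.δ) (c₃ / 2 - 4 * (K * ρ) - Φ.δ)) ≤ η) :
    (bondPercolation (zdGraph 2) half).real
      {ω | (∃ β : ℝ → ℂ, ContinuousOn β (Icc 0 1) ∧ MapsTo β (Icc 0 1) Q'.carrier ∧ β 0 ∈ Q'.side 0 ∧
          β 1 ∈ Q'.side 2 ∧ ∀ t ∈ Icc (0 : ℝ) 1, β t ∉ openEdgeUnion Φ.δ ω) ∧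
        (∃ Kset : Set ℂ, IsCompact Kset ∧ IsConnected Kset ∧ Kset ⊆ Q.carrier ∧
          Kset ⊆ openEdgeUnion Φ.δ ω ∧ (Kset ∩ Q.side 1).Nonempty ∧ (Kset ∩ Q.side 3).Nonempty) ∧
        ∀ t ∈ Q.side 3, ∀ p : Path (Q'.dualWallPt Φ.δ ω) t, range p ⊆ Q.carrier →
          c₃ ≤ Metric.diam (range p)} ≤
      η * (bondPercolation (zdGraph 2) half).real
        {ω | ∃ β : ℝ → ℂ, ContinuousOn β (Icc 0 1) ∧ MapsTo β (Icc 0 1) Q'.carrier ∧ β 0 ∈ Q'.side 0 ∧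
          β 1 ∈ Q'.side 2 ∧ ∀ t ∈ Icc (0 : ℝ) 1, β t ∉ openEdgeUnion Φ.δ ω} := by
  have hδ : 0 < Φ.δ := Φ.hδ
  set μ := bondPercolation (zdGraph 2) half with hμ
  set B : Set (BondConfig (Site 2)) := {ω | ∃ β : ℝ → ℂ, ContinuousOn β (Icc 0 1) ∧
      MapsTo β (Icc 0 1) Q'.carrier ∧ β 0 ∈ Q'.side 0 ∧ β 1 ∈ Q'.side 2 ∧
      ∀ t ∈ Icc (0 : ℝ) 1, β t ∉ openEdgeUnion Φ.δ ω} with hB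
  set Ev : Set (BondConfig (Site 2)) := {ω | (∃ β : ℝ → ℂ, ContinuousOn β (Icc 0 1) ∧
      MapsTo β (Icc 0 1) Q'.carrier ∧ β 0 ∈ Q'.side 0 ∧ β 1 ∈ Q'.side 2 ∧
        ∀ t ∈ Icc (0 : ℝ) 1, β t ∉ openEdgeUnion Φ.δ ω) ∧
      (∃ Kset : Set ℂ, IsCompact Kset ∧ IsConnected Kset ∧ Kset ⊆ Q.carrier ∧
        Kset ⊆ openEdgeUnion Φ.δ ω ∧ (Kset ∩ Q.side 1).Nonempty ∧ (Kset ∩ Q.side 3).Nonempty) ∧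
      ∀ t ∈ Q.side 3, ∀ p : Path (Q'.dualWallPt Φ.δ ω) t, range p ⊆ Q.carrier →
        c₃ ≤ Metric.diam (range p)} with hEv
  set 𝒟 : Set (Set ℂ) := {d | ∃ ω, Q'.bottomCluster Φ.δ ω = d ∧ ω ∈ B} with h𝒟
  have h𝒟c : 𝒟.Countable :=
    ((QuadCrossing.Quad.finite_range_bottomCluster (Q := Q') hδ).subset
      (by rintro d ⟨ω, hω, -⟩; exact ⟨ω, hω⟩)).countable
  set A : Set ℂ → Set (BondConfig (Site 2)) := fun d => {ω | Q'.bottomCluster Φ.δ ω = d} with hA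
  set F : Set ℂ → Set (BondConfig (Site 2)) := fun d =>
    annulusOpenCrossingOff (Q'.revealedB Φ.δ d) (Q'.dualWallPtOf d) Φ.δ (2 * (K * ρ) + 4 * Φ.δ)
      (c₃ / 2 - 4 * (K * ρ) - Φ.δ) with hF
  -- the key inclusion
  have hkey : ∀ ω ∈ Ev, ω ∈ F (Q'.bottomCluster Φ.δ ω) := by
    rintro ω ⟨hdual, hKop, hfar⟩
    have := hΦ.mem_annulusOpenCrossingOff_of_dual hb hc hd hG hcar h0 h1 h3 hρ hρ0 hjoin htame htame'
      hK harc hc₃ hfar hdual hKop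
    show ω ∈ annulusOpenCrossingOff (Q'.revealedB Φ.δ (Q'.bottomCluster Φ.δ ω))
      (Q'.dualWallPtOf (Q'.bottomCluster Φ.δ ω)) Φ.δ (2 * (K * ρ) + 4 * Φ.δ) (c₃ / 2 - 4 * (K * ρ) - Φ.δ)
    rw [← QuadCrossing.Quad.dualWallPt_eq]
    exact this
  -- decoupling over the values of the bottom cluster
  have hEsub : Ev ⊆ ⋃ d ∈ 𝒟, A d ∩ F d := fun ω hω =>
    mem_iUnion₂.2 ⟨Q'.bottomCluster Φ.δ ω, ⟨ω, rfl, hω.1⟩, rfl, hkey ω hω⟩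
  have hUB : (⋃ d ∈ 𝒟, A d) ⊆ B := by
    intro ω' hω'
    obtain ⟨d, hd', hω'd⟩ := mem_iUnion₂.1 hω'
    obtain ⟨ω, hωd, ⟨β, hβc, hβQ, hβ0, hβ1, hβO⟩⟩ := hd'
    have hempty := QuadCrossing.Quad.bottomCluster_inter_side_three_eq_empty_of_dualPath hδ htame'
      hβc hβQ hβ0 hβ1 hβO
    rw [hωd] at hempty
    have hω'eq : Q'.bottomCluster Φ.δ ω' = d := hω'd
    exact QuadCrossing.Quad.exists_dualPath_of_bottomCluster_inter_side_three_eq_empty hδ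
      (by rw [hω'eq]; exact hempty)
  have hAmeas : ∀ d ∈ 𝒟, MeasurableSet (A d) := fun d _ =>
    QuadCrossing.Quad.measurableSet_bottomCluster_eq hδ d
  have hdisj : 𝒟.PairwiseDisjoint A := fun d _ d' _ hne =>
    disjoint_left.2 fun ω (h : Q'.bottomCluster Φ.δ ω = d) (h' : Q'.bottomCluster Φ.δ ω = d') =>
      hne (h.symm.trans h')
  have hprod : ∀ d ∈ 𝒟, μ (A d ∩ F d) = μ (A d) * μ (F d) := fun d hd' =>
    bondPercolation_inter_of_disjoint _ _ disjoint_compl_right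
      (QuadCrossing.Quad.determinedBy_bottomCluster_eq d)
      (determinedBy_annulusOpenCrossingOff _ _ _ _ _) (hAmeas d hd')
      (measurableSet_annulusOpenCrossingOff _ hδ _ _ _)
  have hFle : ∀ d ∈ 𝒟, μ (F d) ≤ ENNReal.ofReal η := fun d _ => by
    refine (measure_mono (annulusOpenCrossingOff_subset _ _ _ _ _)).trans ?_
    rw [← ENNReal.ofReal_toReal (measure_ne_top μ _)]
    exact ENNReal.ofReal_le_ofReal (hη _)
  have hbound := measure_le_mul_of_forall_inter_eq_mul μ h𝒟c hEsub hAmeas hdisj hprod hFle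
  have hEv' : μ Ev ≤ ENNReal.ofReal η * μ B := hbound.trans (by gcongr)
  show (μ Ev).toReal ≤ η * (μ B).toReal
  have := ENNReal.toReal_mono (ENNReal.mul_ne_top ENNReal.ofReal_ne_top (measure_ne_top μ B)) hEv'
  rwa [ENNReal.toReal_mul, ENNReal.toReal_ofReal hη0] at this

end Frame

end SSContinuity

end Literature.Probability.Percolation
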